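import Mathlib
import Literature.Combinatorics.Enumerative.SnakesTypeD
import HarnessLib

/-!
# Arnold's double triangle for the Springer numbers (Arnold 1992; Shin–Zeng 2021, Theorem 2)

[cite: ShinZeng2021ArnoldFamilies, §1 eq. (4) and Theorem 2 (Arnold) (Electron. Res. Arch. 29 (2021) = arXiv:2006.00507, pp. 3–4)]
[cite: Arnold1992Snakes (the original: the pair of triangles computing the Springer numbers)]

Continues `SnakesSpringerNumbers` / `SnakesTypeD` (signed arrangements, snakes of types `B`, `β`, `D`, Hoffman's
Theorems 4.2–4.3) with Arnold's refinement of the Springer numbers by the first letter.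

## Source (verbatim, [ShinZeng2021ArnoldFamilies] §1)

* «An (down-up) alternating permutation of type Bₙ is a signed permutation π ∈ 𝓑ₙ such that π₁ > π₂ < π₃ > π₄ ⋯
  and a snake of type Bₙ is an alternating permutation of type Bₙ starting with a positive entry. Let DU_n^{(B)} be
  the set of (down-up) alternating permutations of type Bₙ and DU_n^B the set of snakes of type Bₙ. Clearly the
  cardinality of DU_n^{(B)} is 2ⁿEₙ. Arnold [Arn92] showed that the Springer number Sₙ enumerates the snakes of type Bₙ.»
* «Arnold [Arn92] introduced the following pair of triangles to compute the Springer numbers: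
  S_{1,−1} / S_{2,2} ← S_{2,1} / S_{3,−3} → S_{3,−2} → S_{3,−1} / S_{4,4} ← S_{4,3} ← S_{4,2} ← S_{4,1} ⇕
  1 / 2 ← 1 / 0 → 2 → 3 / 16 ← 16 ← 14 ← 11, and S_{1,1} / S_{2,−1} ← S_{2,−2} / S_{3,1} → S_{3,2} → S_{3,3} /
  S_{4,−1} ← S_{4,−2} ← S_{4,−3} ← S_{4,−4} ⇕ 1 / 1 ← 0 / 3 → 4 → 4 / 11 ← 8 ← 4 ← 0,
  where S_{n,k} is defined by S_{1,1} = S_{1,−1} = 1, S_{n,−n} = 0 (n ≥ 2), and the recurrence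
  (4) S_{n,k} = S_{n,k−1} + S_{n−1,−k+1} if n ≥ k > 1; S_{n,−1} if n > k = 1; S_{n,k−1} + S_{n−1,−k} if −1 ≥ k > −n.»
* «Theorem 2 (Arnold). For all integers 1 ≤ k ≤ n, the number of the snakes of type Bₙ starting with k is S_{n,k},
  i.e., S_{n,k} = #DU_{n,k}^B with S_n = Σ_{k>0} #DU_{n,k}^B, where DU_{n,k}^B := {σ ∈ DU_n^B : σ₁ = k}. Moreover, for
  all integers −n ≤ k ≤ −1, it holds that S_{n,k} = #{σ ∈ DU_n^{(B)} : σ₁ = k}.»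

## What is typed, and how

We *define* `arnold n k` as the number of down-up signed arrangements of `{1,…,n}` with first letter `k`
(`arnoldCount S a` on any set `S` of absolute values) and PROVE that these numbers satisfy the printed defining system
(4) with its boundary values — which is the content of Arnold's theorem (the system determines `S_{n,k}`).  The proof
is the classical exchange argument, carried out on an arbitrary alphabet `S ⊂ ℕ_{>0}` (so that no relabelling is
needed inside the induction) and transported to `{1,…,n−1}` at the end:

* §3 for consecutive absolute values `k < k'` of `S`, the swap `k ↔ k'` (signs kept, `swapVal`) preserves the order of
  every pair of letters except the same-sign pairs `{k,k'}`, `{−k,−k'}` (`swapVal_lt_iff`); a down-up arrangement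
  starting with `k'` (resp. `−k`) has such an adjacent pair only in first position.  Hence
  `v(S,k') = v(S,k) + #{k' k ⋯}` and `v(S,−k) = v(S,−k') + #{−k (−k') ⋯}` (`card_filter_head_swap_pos/neg`), and
  dropping the first letter and negating, `#{a b ⋯} = v(S ∖ {|a|}, −b)` (`card_filter_head_second`):
  `arnoldCount_pos_step`, `arnoldCount_neg_step`.
* §4 flipping the sign of the least absolute value: `v(S,m) = v(S,−m)` (`arnoldCount_min`); `v(S,−max S) = 0`.
* §5 relabelling `{1,…,n−1} ≅ {1,…,n} ∖ {j}` by the order embedding skipping `±j` (`arnoldCount_erase`).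
* §6 **Arnold's theorem for `S_{n,k} = arnold n k`**: `arnold_pos_step` (`S_{n,k+1} = S_{n,k} + S_{n−1,−k}`),
  `arnold_neg_step` (`S_{n,−k} = S_{n,−(k+1)} + S_{n−1,k}`), `arnold_one` (`S_{n,1} = S_{n,−1}`), `arnold_neg_self`
  (`S_{n,−n} = 0`, `n ≥ 2`), `arnold_one_one` (`S_{1,±1} = 1`).
* §7 row sums: `Σ_{k>0} S_{n,k} = card Bₙ = Qₙ(1) = Sₙ` and `Σ_{k<0} S_{n,k} = card Dₙ = Pₙ(1) − Qₙ(1)`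
  (`card_bSnakes_eq_sum_arnold`, `card_dSnakes_eq_sum_arnold`, `sum_arnold`); rows 1–4 of both triangles by
  enumeration (`arnold_rows`).

No new named facts (net debt 0).
-/

namespace Literature.Combinatorics.Enumerative
namespace Snakes

open List
open Literature.ComputerArithmetic.BrentZimmermann2010

/-! ### §1 Down-up signed arrangements and the counts `v(S, a)` by first letter -/

/-- The (down-up) alternating signed arrangements `σ₁ > σ₂ < σ₃ > ⋯` of a set `S` of absolute values
(`DU_n^{(B)}` for `S = [n]`; Arnold's `βₙ`-snakes in the convention of [ShinZeng2021ArnoldFamilies]).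
[cite: ShinZeng2021ArnoldFamilies, §1 («An (down-up) alternating permutation of type Bₙ is a signed permutation π ∈ 𝓑ₙ such that π₁ > π₂ < π₃ > π₄ ⋯»)] -/
def duSigned (S : Finset ℕ) : Finset (List ℤ) :=
  (signedArrangements S).filter fun x => zigzagWord false x = true

/-- `v(S, a)`: the number of down-up signed arrangements of `S` with first letter `a`.
[cite: ShinZeng2021ArnoldFamilies, Theorem 2 («S_{n,k} = #{σ ∈ DU_n^{(B)} : σ₁ = k}»)] -/
def arnoldCount (S : Finset ℕ) (a : ℤ) : ℕ := ((duSigned S).filter fun x => x.headI = a).card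

/-- **The Arnold numbers** `S_{n,k}` (`1 ≤ |k| ≤ n`), here *defined* combinatorially as the number of down-up
signed permutations of `[n]` with first letter `k` (Arnold's theorem says these satisfy the recurrence (4) of the
double triangle, proved below). [cite: ShinZeng2021ArnoldFamilies, Theorem 2 (Arnold) («for all integers −n ≤ k ≤ −1, it holds that S_{n,k} = #{σ ∈ DU_n^{(B)} : σ₁ = k}»; for k > 0 the snakes of type Bₙ starting with k); Arnold1992Snakes] -/
def arnold (n : ℕ) (k : ℤ) : ℕ := arnoldCount (Finset.Icc 1 n) k

/-- Unfolding. [cite: ShinZeng2021ArnoldFamilies, Theorem 2] -/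
theorem mem_filter_duSigned {S : Finset ℕ} {p : List ℤ → Prop} [DecidablePred p] {x : List ℤ} :
    x ∈ (duSigned S).filter p ↔ x ∈ signedArrangements S ∧ zigzagWord false x = true ∧ p x := by
  simp [duSigned, and_assoc]

/-! ### §2 Tools: relabelling along adjacent pairs, the tail of a snake -/

/-- A relabelling that preserves the order of every *adjacent* pair of letters preserves (reverse) alternation.
[cite: ShinZeng2021ArnoldFamilies, Theorem 2 (proof device)] -/
theorem zigzagWord_map_of_isChain {f : ℤ → ℤ} : ∀ (up : Bool) (w : List ℤ),
    List.IsChain (fun a b => (f a < f b ↔ a < b) ∧ (f b < f a ↔ b < a)) w →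
      zigzagWord up (w.map f) = zigzagWord up w
  | up, [], _ => by simp
  | up, [a], _ => by simp
  | up, a :: b :: w, h => by
      rw [List.isChain_cons_cons] at h
      have ih := zigzagWord_map_of_isChain (!up) (b :: w) h.2
      rw [map_cons] at ih
      rw [map_cons, map_cons, zigzagWord_cons_cons, zigzagWord_cons_cons, ih]
      simp only [h.1.1, h.1.2]

/-- `IsChain` from an all-pairs hypothesis. [folklore] -/
private theorem isChain_of_forall {R : ℤ → ℤ → Prop} : ∀ l : List ℤ, (∀ a ∈ l, ∀ b ∈ l, a ≠ b → R a b) →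
    (l.map Int.natAbs).Nodup → List.IsChain R l
  | [], _, _ => List.IsChain.nil
  | [a], _, _ => List.isChain_singleton a
  | a :: b :: t, h, hnd => by
      rw [List.isChain_cons_cons]
      have hab : a ≠ b := by
        intro hab; subst hab
        rw [map_cons, map_cons, nodup_cons] at hnd
        exact hnd.1 (by simp)
      refine ⟨h a (by simp) b (by simp) hab, isChain_of_forall (b :: t) (fun c hc d hd => h c (mem_cons_of_mem a hc)
        d (mem_cons_of_mem a hd)) ?_⟩
      rw [map_cons] at hnd
      exact hnd.of_cons

/-- The absolute values of a signed arrangement of `S` lie in `S`. [cite: Hoffman1999DerivativePolynomials, §4 Definition] -/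
theorem natAbs_mem_of_mem {S : Finset ℕ} {x : List ℤ} (hx : x ∈ signedArrangements S) {a : ℤ} (ha : a ∈ x) :
    a.natAbs ∈ S := by
  rw [mem_signedArrangements] at hx
  rw [← hx.2, List.mem_toFinset]
  exact mem_map_of_mem ha

/-- ★ **Removing the first letter**: the down-up arrangements `a b ⋯` of `S` with prescribed first two letters
`a > b` correspond (drop `a`, negate) to the down-up arrangements of `S ∖ {|a|}` starting with `−b`.
[cite: ShinZeng2021ArnoldFamilies, Theorem 2 (Arnold) (the terms S_{n−1,−k+1}, S_{n−1,−k} of the recurrence (4))] -/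
theorem card_filter_head_second {S : Finset ℕ} (hS : (0 : ℕ) ∉ S) {a b : ℤ} (ha : a.natAbs ∈ S) (hab : b < a)
    (hb : b ≠ 0) :
    ((duSigned S).filter fun x => x.headI = a ∧ x.tail.headI = b).card = arnoldCount (S.erase a.natAbs) (-b) := by
  have hinv : ∀ w : List ℤ, (w.map Neg.neg).map Neg.neg = w := fun w => by rw [map_map]; simp
  refine Finset.card_nbij' (fun x => x.tail.map Neg.neg) (fun w => a :: w.map Neg.neg) ?_ ?_ ?_ ?_
  · intro x hx
    rw [Finset.mem_coe, mem_filter_duSigned] at hx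
    obtain ⟨hxS, hdu, hh, ht⟩ := hx
    obtain ⟨a', t, rfl⟩ : ∃ a' t, x = a' :: t := by
      cases x with
      | nil => simp at hh; exact absurd hh.symm (by rintro rfl; simp at ha; exact hS ha)
      | cons a' t => exact ⟨a', t, rfl⟩
    simp only [List.headI_cons] at hh; subst hh
    obtain ⟨b', r, rfl⟩ : ∃ b' r, t = b' :: r := by
      cases t with
      | nil => simp at ht; exact absurd ht.symm hb
      | cons b' r => exact ⟨b', r, rfl⟩
    simp only [List.tail_cons, List.headI_cons] at ht; subst ht
    dsimp only
    rw [Finset.mem_coe, mem_filter_duSigned, mem_signedArrangements]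
    rw [mem_signedArrangements] at hxS
    simp only [List.tail_cons, map_cons, map_map, show Int.natAbs ∘ Neg.neg = Int.natAbs from
      funext fun c => Int.natAbs_neg c, List.headI_cons, Int.natAbs_neg]
    rw [map_cons, map_cons, nodup_cons] at hxS
    refine ⟨⟨hxS.1.2, ?_⟩, ?_, trivial⟩
    · have h1 : a'.natAbs ∉ (b'.natAbs :: map Int.natAbs r).toFinset := by
        rw [List.mem_toFinset]; exact hxS.1.1
      rw [← hxS.2, List.toFinset_cons (l := b'.natAbs :: map Int.natAbs r), Finset.erase_insert h1]
    · have := zigzagWord_map_neg false (b' :: r)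
      rw [map_cons] at this
      rw [this]
      exact ((zigzagWord_false_cons_cons _ _ _).1 hdu).2
  · intro w hw
    rw [Finset.mem_coe, mem_filter_duSigned, mem_signedArrangements] at hw
    obtain ⟨⟨hnd, hset⟩, hdu, hh⟩ := hw
    obtain ⟨c, r, rfl⟩ : ∃ c r, w = c :: r := by
      cases w with
      | nil => simp at hh; exact absurd hh (by omega)
      | cons c r => exact ⟨c, r, rfl⟩
    simp only [List.headI_cons] at hh; subst hh
    show a :: (-b :: r).map Neg.neg ∈ ((duSigned S).filter fun x => x.headI = a ∧ x.tail.headI = b)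
    rw [mem_filter_duSigned, mem_signedArrangements]
    simp only [map_cons, map_map, show Int.natAbs ∘ Neg.neg = Int.natAbs from funext fun c => Int.natAbs_neg c,
      neg_neg, List.headI_cons, List.tail_cons]
    simp only [map_cons, Int.natAbs_neg] at hset hnd
    have hnot : a.natAbs ∉ b.natAbs :: r.map Int.natAbs := by
      rw [← List.mem_toFinset, hset]; exact Finset.notMem_erase _ _
    refine ⟨⟨nodup_cons.2 ⟨hnot, hnd⟩, ?_⟩, ?_, trivial, trivial⟩
    · rw [List.toFinset_cons, hset, Finset.insert_erase ha]
    · rw [zigzagWord_false_cons_cons]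
      refine ⟨hab, ?_⟩
      have := zigzagWord_map_neg true (-b :: r)
      simp only [map_cons, neg_neg, Bool.not_true] at this
      rw [this]; exact hdu
  · intro x hx
    rw [Finset.mem_coe, mem_filter_duSigned] at hx
    obtain ⟨-, -, hh, ht⟩ := hx
    cases x with
    | nil => simp at hh; exact absurd hh.symm (by rintro rfl; simp at ha; exact hS ha)
    | cons a' t => simp only [List.headI_cons] at hh; subst hh; simp [hinv]
  · intro w _
    simp [hinv]

/-! ### §3 Arnold's value swap `k ↔ k'` for consecutive absolute values -/

/-- Exchange the absolute values `k` and `k'`, keeping signs. [cite: ShinZeng2021ArnoldFamilies, Theorem 2 (Arnold) (proof device for the recurrence (4))] -/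
def swapVal (k k' : ℕ) (a : ℤ) : ℤ :=
  if a = k then k' else if a = -(k : ℤ) then -k' else if a = k' then k else if a = -(k' : ℤ) then -k else a

/-- The «bad» adjacent pairs: the two letters of absolute values `k`, `k'` with the same sign, whose order the
swap reverses. [cite: ShinZeng2021ArnoldFamilies, Theorem 2 (Arnold) (proof device)] -/
def badPair (k k' : ℕ) (a b : ℤ) : Prop :=
  (a = k ∧ b = k') ∨ (a = k' ∧ b = k) ∨ (a = -(k : ℤ) ∧ b = -(k' : ℤ)) ∨ (a = -(k' : ℤ) ∧ b = -(k : ℤ))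

/-- The swap is an involution. [cite: ShinZeng2021ArnoldFamilies, Theorem 2 (proof device)] -/
theorem swapVal_swapVal {k k' : ℕ} (hk : 0 < k) (hk' : 0 < k') (a : ℤ) : swapVal k k' (swapVal k k' a) = a := by
  unfold swapVal; split_ifs <;> omega

/-- On absolute values the swap is the transposition `(k k')`. [cite: ShinZeng2021ArnoldFamilies, Theorem 2 (proof device)] -/
theorem natAbs_swapVal {k k' : ℕ} (hk : 0 < k) (hk' : 0 < k') (a : ℤ) :
    (swapVal k k' a).natAbs = Equiv.swap k k' a.natAbs := by
  unfold swapVal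
  rw [Equiv.swap_apply_def]
  split_ifs <;> omega

/-- `toFinset` commutes with `map`. [folklore] -/
private theorem toFinset_map_nat' (l : List ℕ) (f : ℕ → ℕ) : (l.map f).toFinset = l.toFinset.image f := by
  ext a
  simp only [List.mem_toFinset, List.mem_map, Finset.mem_image]

/-- The swap preserves the signed arrangements of `S` (`k, k' ∈ S`). [cite: ShinZeng2021ArnoldFamilies, Theorem 2 (proof device)] -/
theorem map_swapVal_mem {S : Finset ℕ} {k k' : ℕ} (hS0 : (0 : ℕ) ∉ S) (hk : k ∈ S) (hk' : k' ∈ S) {x : List ℤ}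
    (hx : x ∈ signedArrangements S) : x.map (swapVal k k') ∈ signedArrangements S := by
  have hk0 : 0 < k := Nat.pos_of_ne_zero fun h => hS0 (h ▸ hk)
  have hk0' : 0 < k' := Nat.pos_of_ne_zero fun h => hS0 (h ▸ hk')
  rw [mem_signedArrangements] at hx ⊢
  have hmap : (x.map (swapVal k k')).map Int.natAbs = (x.map Int.natAbs).map (Equiv.swap k k') := by
    rw [map_map, map_map]; exact map_congr_left fun a _ => natAbs_swapVal hk0 hk0' a
  rw [hmap]
  refine ⟨hx.1.map (Equiv.injective _), ?_⟩
  rw [toFinset_map_nat', hx.2]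
  ext c
  simp only [Finset.mem_image]
  constructor
  · rintro ⟨d, hd, rfl⟩
    rcases eq_or_ne d k with rfl | h1
    · rw [Equiv.swap_apply_left]; exact hk'
    rcases eq_or_ne d k' with rfl | h2
    · rw [Equiv.swap_apply_right]; exact hk
    · rw [Equiv.swap_apply_of_ne_of_ne h1 h2]; exact hd
  · intro hc
    refine ⟨Equiv.swap k k' c, ?_, Equiv.swap_apply_self _ _ _⟩
    rcases eq_or_ne c k with rfl | h1
    · rw [Equiv.swap_apply_left]; exact hk'
    rcases eq_or_ne c k' with rfl | h2
    · rw [Equiv.swap_apply_right]; exact hk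
    · rw [Equiv.swap_apply_of_ne_of_ne h1 h2]; exact hc

/-- ★ **The swap preserves the order of every pair that is not bad**, provided `k < k'` are *consecutive* absolute
values of `S`. [cite: ShinZeng2021ArnoldFamilies, Theorem 2 (Arnold) (proof device)] -/
theorem swapVal_lt_iff {S : Finset ℕ} {k k' : ℕ} (hS0 : (0 : ℕ) ∉ S) (hkk : k < k')
    (hcons : ∀ c ∈ S, ¬(k < c ∧ c < k')) {a b : ℤ} (ha : a.natAbs ∈ S) (hb : b.natAbs ∈ S)
    (hab : a.natAbs ≠ b.natAbs) (hbad : ¬badPair k k' a b) : swapVal k k' a < swapVal k k' b ↔ a < b := by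
  have hca := hcons _ ha
  have hcb := hcons _ hb
  have ha0 : a.natAbs ≠ 0 := fun h => hS0 (h ▸ ha)
  have hb0 : b.natAbs ≠ 0 := fun h => hS0 (h ▸ hb)
  unfold badPair at hbad
  unfold swapVal
  split_ifs <;> omega

/-- Transfer of a chain condition along the letters of a word with distinct absolute values. [folklore] -/
private theorem isChain_imp_of_mem {P R : ℤ → ℤ → Prop} : ∀ l : List ℤ,
    (∀ a b, a ∈ l → b ∈ l → a.natAbs ≠ b.natAbs → P a b → R a b) → (l.map Int.natAbs).Nodup →
      List.IsChain P l → List.IsChain R l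
  | [], _, _, _ => List.IsChain.nil
  | [a], _, _, _ => List.isChain_singleton a
  | a :: b :: t, h, hnd, hP => by
      rw [List.isChain_cons_cons] at hP ⊢
      have hab : a.natAbs ≠ b.natAbs := by
        intro hab
        rw [map_cons, map_cons, nodup_cons] at hnd
        exact hnd.1 (by rw [hab]; simp)
      refine ⟨h a b (by simp) (by simp) hab hP.1, isChain_imp_of_mem (b :: t)
        (fun c d hc hd => h c d (mem_cons_of_mem a hc) (mem_cons_of_mem a hd)) ?_ hP.2⟩
      rw [map_cons] at hnd
      exact hnd.of_cons

/-- The swap preserves (reverse) alternation of a signed arrangement of `S` with no bad adjacent pair.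
[cite: ShinZeng2021ArnoldFamilies, Theorem 2 (Arnold) (proof device)] -/
theorem zigzagWord_map_swapVal {S : Finset ℕ} {k k' : ℕ} (hS0 : (0 : ℕ) ∉ S) (hkk : k < k')
    (hcons : ∀ c ∈ S, ¬(k < c ∧ c < k')) {x : List ℤ} (hx : x ∈ signedArrangements S)
    (hchain : List.IsChain (fun a b => ¬badPair k k' a b) x) (up : Bool) :
    zigzagWord up (x.map (swapVal k k')) = zigzagWord up x := by
  refine zigzagWord_map_of_isChain up x (isChain_imp_of_mem x (fun a b ha hb hab hP => ?_)
    ((mem_signedArrangements.1 hx).1) hchain)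
  exact ⟨swapVal_lt_iff hS0 hkk hcons (natAbs_mem_of_mem hx ha) (natAbs_mem_of_mem hx hb) hab hP,
    swapVal_lt_iff hS0 hkk hcons (natAbs_mem_of_mem hx hb) (natAbs_mem_of_mem hx ha) hab.symm fun h => hP (by
      unfold badPair at h ⊢; omega)⟩

/-- A word whose tail avoids the absolute value of its head `h ∈ {±k, ±k'}` and whose second letter is not the
bad partner `e` of `h` has no bad adjacent pair. [cite: ShinZeng2021ArnoldFamilies, Theorem 2 (proof device)] -/
theorem isChain_not_badPair {S : Finset ℕ} {k k' : ℕ} (hk0 : 0 < k) (hkk : k < k') {h e : ℤ} {t : List ℤ}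
    (hx : (h :: t) ∈ signedArrangements S) (hh : h.natAbs = k ∨ h.natAbs = k')
    (he : ∀ b, badPair k k' h b → b = e) (ht : t.headI ≠ e) :
    List.IsChain (fun a b => ¬badPair k k' a b) (h :: t) := by
  have hnd := (mem_signedArrangements.1 hx).1
  rw [map_cons, nodup_cons] at hnd
  have hnot : ∀ c ∈ t, c.natAbs ≠ h.natAbs := fun c hc hch => hnd.1 (by rw [← hch]; exact mem_map_of_mem hc)
  cases t with
  | nil => exact List.isChain_singleton h
  | cons b t =>
      rw [List.isChain_cons_cons]
      refine ⟨fun hb => ht (by simpa using he b hb), isChain_of_forall (b :: t) (fun c hc d hd _ hbad => ?_) hnd.2⟩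
      have h1 := hnot c hc
      have h2 := hnot d hd
      unfold badPair at hbad
      rcases hh with hh | hh <;> omega

/-- ★★ **The swap bijection, positive side**: the down-up arrangements starting `k' b ⋯` with `b ≠ k` correspond
under `k ↔ k'` to those starting with `k` (`k < k'` consecutive in `S`).
[cite: ShinZeng2021ArnoldFamilies, Theorem 2 (Arnold), recurrence (4) first line («S_{n,k} = S_{n,k−1} + S_{n−1,−k+1} if n ≥ k > 1»)] -/
theorem card_filter_head_swap_pos {S : Finset ℕ} {k k' : ℕ} (hS0 : (0 : ℕ) ∉ S) (hk : k ∈ S) (hk' : k' ∈ S)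
    (hkk : k < k') (hcons : ∀ c ∈ S, ¬(k < c ∧ c < k')) :
    ((duSigned S).filter fun x => x.headI = (k' : ℤ) ∧ x.tail.headI ≠ (k : ℤ)).card = arnoldCount S (k : ℤ) := by
  have hk0 : 0 < k := Nat.pos_of_ne_zero fun h => hS0 (h ▸ hk)
  have hk0' : 0 < k' := lt_trans hk0 hkk
  have hinv : ∀ x : List ℤ, (x.map (swapVal k k')).map (swapVal k k') = x := fun x => by
    rw [map_map]; conv_rhs => rw [← map_id x]
    exact map_congr_left fun a _ => swapVal_swapVal hk0 hk0' a
  refine Finset.card_nbij' (fun x => x.map (swapVal k k')) (fun x => x.map (swapVal k k')) ?_ ?_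
    (fun x _ => hinv x) (fun x _ => hinv x)
  · intro x hx
    rw [Finset.mem_coe, mem_filter_duSigned] at hx
    obtain ⟨hxS, hdu, hh, ht⟩ := hx
    obtain ⟨h, t, rfl⟩ : ∃ h t, x = h :: t := by
      cases x with
      | nil => simp at hh; omega
      | cons h t => exact ⟨h, t, rfl⟩
    simp only [List.headI_cons] at hh; subst hh
    simp only [List.tail_cons] at ht
    have hchain := isChain_not_badPair hk0 hkk hxS (by simp) (e := (k : ℤ))
      (fun b hb => by unfold badPair at hb; omega) ht
    rw [Finset.mem_coe, mem_filter_duSigned]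
    refine ⟨map_swapVal_mem hS0 hk hk' hxS, by rw [zigzagWord_map_swapVal hS0 hkk hcons hxS hchain]; exact hdu, ?_⟩
    simp only [map_cons, List.headI_cons]
    unfold swapVal; split_ifs <;> omega
  · intro y hy
    rw [Finset.mem_coe, mem_filter_duSigned] at hy
    obtain ⟨hyS, hdu, hh⟩ := hy
    obtain ⟨h, t, rfl⟩ : ∃ h t, y = h :: t := by
      cases y with
      | nil => simp at hh; omega
      | cons h t => exact ⟨h, t, rfl⟩
    simp only [List.headI_cons] at hh; subst hh
    have ht : t.headI ≠ (k' : ℤ) := by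
      cases t with
      | nil => simp; omega
      | cons b t => simp only [List.headI_cons]; have := ((zigzagWord_false_cons_cons _ _ _).1 hdu).1; omega
    have hchain := isChain_not_badPair hk0 hkk hyS (by simp) (e := (k' : ℤ))
      (fun b hb => by unfold badPair at hb; omega) ht
    rw [Finset.mem_coe, mem_filter_duSigned]
    refine ⟨map_swapVal_mem hS0 hk hk' hyS, by rw [zigzagWord_map_swapVal hS0 hkk hcons hyS hchain]; exact hdu,
      ?_, ?_⟩
    · simp only [map_cons, List.headI_cons]; unfold swapVal; split_ifs <;> omega
    · cases t with
      | nil => simp; omega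
      | cons b t =>
          simp only [map_cons, List.tail_cons, List.headI_cons]
          have hb : b < k := ((zigzagWord_false_cons_cons _ _ _).1 hdu).1
          have hbn : b.natAbs ≠ k := by
            have hnd := (mem_signedArrangements.1 hyS).1
            rw [map_cons, nodup_cons] at hnd
            intro hbk; exact hnd.1 (by rw [show (k : ℤ).natAbs = b.natAbs by rw [hbk]; simp]; simp)
          unfold swapVal; split_ifs <;> omega

/-- ★★ **The swap bijection, negative side**: the down-up arrangements starting `−k b ⋯` with `b ≠ −k'`
correspond under `k ↔ k'` to those starting with `−k'`.
[cite: ShinZeng2021ArnoldFamilies, Theorem 2 (Arnold), recurrence (4) third line («S_{n,k} = S_{n,k−1} + S_{n−1,−k} if −1 ≥ k > −n»)] -/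
theorem card_filter_head_swap_neg {S : Finset ℕ} {k k' : ℕ} (hS0 : (0 : ℕ) ∉ S) (hk : k ∈ S) (hk' : k' ∈ S)
    (hkk : k < k') (hcons : ∀ c ∈ S, ¬(k < c ∧ c < k')) :
    ((duSigned S).filter fun x => x.headI = -(k : ℤ) ∧ x.tail.headI ≠ -(k' : ℤ)).card = arnoldCount S (-(k' : ℤ)) := by
  have hk0 : 0 < k := Nat.pos_of_ne_zero fun h => hS0 (h ▸ hk)
  have hk0' : 0 < k' := lt_trans hk0 hkk
  have hinv : ∀ x : List ℤ, (x.map (swapVal k k')).map (swapVal k k') = x := fun x => by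
    rw [map_map]; conv_rhs => rw [← map_id x]
    exact map_congr_left fun a _ => swapVal_swapVal hk0 hk0' a
  refine Finset.card_nbij' (fun x => x.map (swapVal k k')) (fun x => x.map (swapVal k k')) ?_ ?_
    (fun x _ => hinv x) (fun x _ => hinv x)
  · intro x hx
    rw [Finset.mem_coe, mem_filter_duSigned] at hx
    obtain ⟨hxS, hdu, hh, ht⟩ := hx
    obtain ⟨h, t, rfl⟩ : ∃ h t, x = h :: t := by
      cases x with
      | nil => simp at hh; omega
      | cons h t => exact ⟨h, t, rfl⟩
    simp only [List.headI_cons] at hh; subst hh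
    simp only [List.tail_cons] at ht
    have hchain := isChain_not_badPair hk0 hkk hxS (by simp) (e := -(k' : ℤ))
      (fun b hb => by unfold badPair at hb; omega) ht
    rw [Finset.mem_coe, mem_filter_duSigned]
    refine ⟨map_swapVal_mem hS0 hk hk' hxS, by rw [zigzagWord_map_swapVal hS0 hkk hcons hxS hchain]; exact hdu, ?_⟩
    simp only [map_cons, List.headI_cons]
    unfold swapVal; split_ifs <;> omega
  · intro y hy
    rw [Finset.mem_coe, mem_filter_duSigned] at hy
    obtain ⟨hyS, hdu, hh⟩ := hy
    obtain ⟨h, t, rfl⟩ : ∃ h t, y = h :: t := by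
      cases y with
      | nil => simp at hh; omega
      | cons h t => exact ⟨h, t, rfl⟩
    simp only [List.headI_cons] at hh; subst hh
    have ht : t.headI ≠ -(k : ℤ) := by
      cases t with
      | nil => simp; omega
      | cons b t => simp only [List.headI_cons]; have := ((zigzagWord_false_cons_cons _ _ _).1 hdu).1; omega
    have hchain := isChain_not_badPair hk0 hkk hyS (by simp) (e := -(k : ℤ))
      (fun b hb => by unfold badPair at hb; omega) ht
    rw [Finset.mem_coe, mem_filter_duSigned]
    refine ⟨map_swapVal_mem hS0 hk hk' hyS, by rw [zigzagWord_map_swapVal hS0 hkk hcons hyS hchain]; exact hdu,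
      ?_, ?_⟩
    · simp only [map_cons, List.headI_cons]; unfold swapVal; split_ifs <;> omega
    · cases t with
      | nil => simp; omega
      | cons b t =>
          simp only [map_cons, List.tail_cons, List.headI_cons]
          have hb : b < -(k' : ℤ) := ((zigzagWord_false_cons_cons _ _ _).1 hdu).1
          unfold swapVal; split_ifs <;> omega

/-- Splitting `v(S, a)` by the second letter. [cite: ShinZeng2021ArnoldFamilies, Theorem 2 (proof device)] -/
theorem arnoldCount_eq_add (S : Finset ℕ) (a e : ℤ) :
    arnoldCount S a = ((duSigned S).filter fun x => x.headI = a ∧ x.tail.headI ≠ e).card +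
      ((duSigned S).filter fun x => x.headI = a ∧ x.tail.headI = e).card := by
  rw [arnoldCount, ← Finset.card_filter_add_card_filter_not (p := fun x : List ℤ => x.tail.headI ≠ e),
    Finset.filter_filter, Finset.filter_filter]
  simp only [not_not]

/-- ★★★ **Arnold's recurrence, positive side, on any set of absolute values**: for consecutive `k < k'` in `S`,
`v(S, k') = v(S, k) + v(S ∖ {k'}, −k)`. [cite: ShinZeng2021ArnoldFamilies, Theorem 2 (Arnold) with (4) («S_{n,k} = S_{n,k−1} + S_{n−1,−k+1} if n ≥ k > 1»); Arnold1992Snakes] -/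
theorem arnoldCount_pos_step {S : Finset ℕ} {k k' : ℕ} (hS0 : (0 : ℕ) ∉ S) (hk : k ∈ S) (hk' : k' ∈ S)
    (hkk : k < k') (hcons : ∀ c ∈ S, ¬(k < c ∧ c < k')) :
    arnoldCount S (k' : ℤ) = arnoldCount S (k : ℤ) + arnoldCount (S.erase k') (-(k : ℤ)) := by
  have hk0 : 0 < k := Nat.pos_of_ne_zero fun h => hS0 (h ▸ hk)
  rw [arnoldCount_eq_add S (k' : ℤ) (k : ℤ), card_filter_head_swap_pos hS0 hk hk' hkk hcons,
    card_filter_head_second hS0 (by simpa using hk') (by exact_mod_cast hkk) (by omega)]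
  simp

/-- ★★★ **Arnold's recurrence, negative side**: for consecutive `k < k'` in `S`,
`v(S, −k) = v(S, −k') + v(S ∖ {k}, k')`. [cite: ShinZeng2021ArnoldFamilies, Theorem 2 (Arnold) with (4) («S_{n,k} = S_{n,k−1} + S_{n−1,−k} if −1 ≥ k > −n»); Arnold1992Snakes] -/
theorem arnoldCount_neg_step {S : Finset ℕ} {k k' : ℕ} (hS0 : (0 : ℕ) ∉ S) (hk : k ∈ S) (hk' : k' ∈ S)
    (hkk : k < k') (hcons : ∀ c ∈ S, ¬(k < c ∧ c < k')) :
    arnoldCount S (-(k : ℤ)) = arnoldCount S (-(k' : ℤ)) + arnoldCount (S.erase k) (k' : ℤ) := by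
  have hk0 : 0 < k := Nat.pos_of_ne_zero fun h => hS0 (h ▸ hk)
  rw [arnoldCount_eq_add S (-(k : ℤ)) (-(k' : ℤ)), card_filter_head_swap_neg hS0 hk hk' hkk hcons,
    card_filter_head_second hS0 (by simpa using hk) (by omega) (by omega)]
  simp

/-! ### §4 The first column: `v(S, m) = v(S, −m)` for the least absolute value, `v(S, −M) = 0` for the greatest -/

/-- Flip the sign of the letter of absolute value `m`. [cite: ShinZeng2021ArnoldFamilies, (4) second line («S_{n,1} = S_{n,−1} if n > k = 1»)] -/
def flipVal (m : ℕ) (a : ℤ) : ℤ := if a.natAbs = m then -a else a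

/-- ★★ **`S_{n,1} = S_{n,−1}`, on any alphabet**: flipping the sign of the least absolute value `m` is an
order-preserving involution of the signed arrangements, exchanging first letter `m` with first letter `−m`.
[cite: ShinZeng2021ArnoldFamilies, Theorem 2 (Arnold) with (4) («S_{n,k} = S_{n,−1} if n > k = 1»); Arnold1992Snakes] -/
theorem arnoldCount_min {S : Finset ℕ} {m : ℕ} (hmin : ∀ c ∈ S, m ≤ c) :
    arnoldCount S (m : ℤ) = arnoldCount S (-(m : ℤ)) := by
  have hinv : ∀ x : List ℤ, (x.map (flipVal m)).map (flipVal m) = x := fun x => by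
    rw [map_map]; conv_rhs => rw [← map_id x]
    exact map_congr_left fun a _ => by simp only [Function.comp, id, flipVal]; split_ifs <;> omega
  have hmem : ∀ x ∈ signedArrangements S, x.map (flipVal m) ∈ signedArrangements S := fun x hx => by
    rw [mem_signedArrangements] at hx ⊢
    rwa [map_map, show Int.natAbs ∘ flipVal m = Int.natAbs from funext fun a => by
      unfold flipVal; simp only [Function.comp]; split_ifs <;> simp]
  have hmono : ∀ x ∈ signedArrangements S, StrictMonoOn (flipVal m) {a | a ∈ x} := fun x hx a ha b hb hab => by
    have h1 := hmin _ (natAbs_mem_of_mem hx ha)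
    have h2 := hmin _ (natAbs_mem_of_mem hx hb)
    have h3 : a.natAbs ≠ b.natAbs := fun h => hab.ne (List.inj_on_of_nodup_map (mem_signedArrangements.1 hx).1 ha hb h)
    unfold flipVal; split_ifs <;> omega
  have hzz : ∀ x ∈ signedArrangements S, zigzagWord false (x.map (flipVal m)) = zigzagWord false x := fun x hx =>
    zigzagWord_map_of_strictMonoOn (hmono x hx) false x fun _ h => h
  unfold arnoldCount
  refine Finset.card_nbij' (fun x => x.map (flipVal m)) (fun x => x.map (flipVal m)) ?_ ?_ (fun x _ => hinv x)
    (fun x _ => hinv x)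
  · intro x hx
    rw [Finset.mem_coe, mem_filter_duSigned] at hx ⊢
    refine ⟨hmem x hx.1, by rw [hzz x hx.1]; exact hx.2.1, ?_⟩
    cases x with
    | nil => have := hx.2.2; simp at this ⊢; omega
    | cons a t => have := hx.2.2; simp only [List.headI_cons, map_cons] at this ⊢; subst this; simp [flipVal]
  · intro x hx
    rw [Finset.mem_coe, mem_filter_duSigned] at hx ⊢
    refine ⟨hmem x hx.1, by rw [hzz x hx.1]; exact hx.2.1, ?_⟩
    cases x with
    | nil => have := hx.2.2; simp at this ⊢; omega
    | cons a t => have := hx.2.2; simp only [List.headI_cons, map_cons] at this ⊢; subst this; simp [flipVal]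

/-- ★ **`S_{n,−n} = 0` (`n ≥ 2`), on any alphabet**: no down-up arrangement of at least two letters starts with
the least possible letter `−M`, `M = max S`. [cite: ShinZeng2021ArnoldFamilies, (4) boundary values («S_{n,−n} = 0 (n ≥ 2)»)] -/
theorem arnoldCount_neg_max {S : Finset ℕ} {M : ℕ} (hmax : ∀ c ∈ S, c ≤ M) (hcard : 2 ≤ S.card) :
    arnoldCount S (-(M : ℤ)) = 0 := by
  unfold arnoldCount
  rw [Finset.card_eq_zero, Finset.filter_eq_empty_iff]
  intro x hx
  rw [duSigned, Finset.mem_filter, mem_signedArrangements] at hx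
  obtain ⟨⟨hnd, hset⟩, hdu⟩ := hx
  have hlen : x.length = S.card := by
    rw [← hset, List.toFinset_card_of_nodup hnd, length_map]
  match x, hlen, hdu, hset with
  | [], hlen, _, _ => simp at hlen; omega
  | [a], hlen, _, _ => simp at hlen; omega
  | a :: b :: t, _, hdu, hset =>
      simp only [List.headI_cons]
      intro ha
      have hb : b.natAbs ∈ S := by rw [← hset]; simp
      have := hmax _ hb
      have hlt := ((zigzagWord_false_cons_cons _ _ _).1 hdu).1
      omega

/-! ### §5 Relabelling: removing one absolute value from `{1, …, n}` -/

/-- The order embedding of the nonzero integers that skips `±j`. [folklore] -/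
def skipVal (j : ℕ) (a : ℤ) : ℤ := if a.natAbs < j then a else if 0 < a then a + 1 else a - 1

/-- Its inverse on the letters of absolute value `≠ j`. [folklore] -/
def unskipVal (j : ℕ) (a : ℤ) : ℤ := if a.natAbs < j then a else if 0 < a then a - 1 else a + 1

/-- `skipVal j` is strictly increasing. [folklore] -/
private theorem skipVal_strictMono (j : ℕ) : StrictMono (skipVal j) := by
  intro a b hab; unfold skipVal; split_ifs <;> omega

/-- `unskipVal j` is strictly increasing on the letters of absolute value `≠ j`. [folklore] -/
private theorem unskipVal_strictMonoOn {j : ℕ} (hj : 1 ≤ j) : StrictMonoOn (unskipVal j) {a : ℤ | a.natAbs ≠ j} := by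
  intro a ha b hb hab
  simp only [Set.mem_setOf_eq] at ha hb
  unfold unskipVal; split_ifs <;> omega

/-- ★ **Relabelling invariance**: the counts for `{1, …, n−1}` and first letter `c` equal the counts for
`{1, …, n} ∖ {j}` and first letter `skipVal j c` (`1 ≤ j ≤ n`) — only the relative order of the letters matters.
[cite: ShinZeng2021ArnoldFamilies, Theorem 2 (Arnold) (the passage from S_{n,·} to S_{n−1,·} in (4))] -/
theorem arnoldCount_erase {n j : ℕ} (hj : 1 ≤ j) (hjn : j ≤ n) (c : ℤ) :
    arnoldCount (Finset.Icc 1 (n - 1)) c = arnoldCount ((Finset.Icc 1 n).erase j) (skipVal j c) := by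
  have hus : ∀ a : ℤ, unskipVal j (skipVal j a) = a := fun a => by unfold unskipVal skipVal; split_ifs <;> omega
  have hsu : ∀ a : ℤ, a.natAbs ≠ j → skipVal j (unskipVal j a) = a := fun a ha => by
    unfold unskipVal skipVal; split_ifs <;> omega
  have hnat_s : ∀ a : ℤ, (skipVal j a).natAbs = if a.natAbs < j then a.natAbs else a.natAbs + 1 := fun a => by
    unfold skipVal; split_ifs <;> omega
  have hnat_u : ∀ a : ℤ, a.natAbs ≠ j →
      (unskipVal j a).natAbs = if a.natAbs < j then a.natAbs else a.natAbs - 1 := fun a ha => by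
    unfold unskipVal; split_ifs <;> omega
  unfold arnoldCount
  refine Finset.card_nbij' (fun x => x.map (skipVal j)) (fun x => x.map (unskipVal j)) ?_ ?_ ?_ ?_
  · intro x hx
    rw [Finset.mem_coe, mem_filter_duSigned, mem_signedArrangements] at hx
    obtain ⟨⟨hnd, hset⟩, hdu, hh⟩ := hx
    rw [Finset.mem_coe, mem_filter_duSigned, mem_signedArrangements, map_map,
      show Int.natAbs ∘ skipVal j = (fun i => if i < j then i else i + 1) ∘ Int.natAbs from funext fun a => hnat_s a,
      ← map_map]
    refine ⟨⟨hnd.map fun u v huv => by split_ifs at huv <;> omega, ?_⟩, ?_, ?_⟩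
    · rw [toFinset_map_nat', hset]
      ext i
      simp only [Finset.mem_image, Finset.mem_Icc, Finset.mem_erase]
      constructor
      · rintro ⟨u, ⟨h1, h2⟩, rfl⟩; split_ifs <;> omega
      · rintro ⟨h1, h2, h3⟩
        refine ⟨if i < j then i else i - 1, ?_, ?_⟩ <;> split_ifs <;> omega
    · rw [zigzagWord_map_of_strictMonoOn ((skipVal_strictMono j).strictMonoOn Set.univ) false x fun _ _ => trivial]
      exact hdu
    · cases x with
      | nil => simp at hh ⊢; subst hh; unfold skipVal; simp; omega
      | cons a t => simp only [List.headI_cons, map_cons] at hh ⊢; rw [hh]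
  · intro y hy
    rw [Finset.mem_coe, mem_filter_duSigned, mem_signedArrangements] at hy
    obtain ⟨⟨hnd, hset⟩, hdu, hh⟩ := hy
    have hne : ∀ a ∈ y, a.natAbs ≠ j := fun a ha haj => by
      have : a.natAbs ∈ (y.map Int.natAbs).toFinset := by rw [List.mem_toFinset]; exact mem_map_of_mem ha
      rw [hset, haj] at this; exact Finset.notMem_erase j _ this
    rw [Finset.mem_coe, mem_filter_duSigned, mem_signedArrangements, map_map]
    have hmapeq : y.map (Int.natAbs ∘ unskipVal j) = (y.map Int.natAbs).map fun i => if i < j then i else i - 1 := by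
      rw [map_map]; exact map_congr_left fun a ha => hnat_u a (hne a ha)
    rw [hmapeq]
    refine ⟨⟨hnd.map_on fun u hu v hv huv => ?_, ?_⟩, ?_, ?_⟩
    · have hu' : u ∈ (y.map Int.natAbs).toFinset := List.mem_toFinset.2 hu
      have hv' : v ∈ (y.map Int.natAbs).toFinset := List.mem_toFinset.2 hv
      rw [hset, Finset.mem_erase] at hu' hv'
      split_ifs at huv <;> omega
    · rw [toFinset_map_nat', hset]
      ext i
      simp only [Finset.mem_image, Finset.mem_Icc, Finset.mem_erase]
      constructor
      · rintro ⟨u, ⟨h1, h2, h3⟩, rfl⟩; split_ifs <;> omega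
      · rintro ⟨h1, h2⟩
        refine ⟨if i < j then i else i + 1, ?_, ?_⟩ <;> split_ifs <;> omega
    · rw [zigzagWord_map_of_strictMonoOn (unskipVal_strictMonoOn hj) false y fun a ha => hne a ha]
      exact hdu
    · cases y with
      | nil =>
          simp at hh ⊢
          have : c = 0 := by rw [← hus c, ← hh]; unfold unskipVal; simp; omega
          exact this.symm
      | cons a t => simp only [List.headI_cons, map_cons] at hh ⊢; rw [hh, hus]
  · intro x _
    show (x.map (skipVal j)).map (unskipVal j) = x
    rw [map_map]; conv_rhs => rw [← map_id x]
    exact map_congr_left fun a _ => hus a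
  · intro y hy
    rw [Finset.mem_coe, mem_filter_duSigned] at hy
    have hne : ∀ a ∈ y, a.natAbs ≠ j := fun a ha haj => by
      have h := natAbs_mem_of_mem hy.1 ha
      rw [haj] at h; exact Finset.notMem_erase j _ h
    show (y.map (unskipVal j)).map (skipVal j) = y
    rw [map_map]; conv_rhs => rw [← map_id y]
    exact map_congr_left fun a ha => hsu a (hne a ha)

/-! ### §6 Arnold's theorem for `S_{n,k}` -/

/-- ★★★ **(4), first line**: `S_{n,k+1} = S_{n,k} + S_{n−1,−k}` for `1 ≤ k < n`
(printed as `S_{n,k} = S_{n,k−1} + S_{n−1,−k+1}` for `n ≥ k > 1`).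
[cite: ShinZeng2021ArnoldFamilies, Theorem 2 (Arnold) and (4) («S_{n,k} = S_{n,k−1} + S_{n−1,−k+1} if n ≥ k > 1»); Arnold1992Snakes] -/
theorem arnold_pos_step {n k : ℕ} (hk : 1 ≤ k) (hkn : k + 1 ≤ n) :
    arnold n ((k : ℤ) + 1) = arnold n k + arnold (n - 1) (-(k : ℤ)) := by
  have h := arnoldCount_pos_step (S := Finset.Icc 1 n) (k := k) (k' := k + 1) (by simp) (by simp; omega)
    (by simp; omega) (by omega) (fun c _ => by omega)
  have h2 := arnoldCount_erase (n := n) (j := k + 1) (by omega) hkn (-(k : ℤ))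
  have hskip : skipVal (k + 1) (-(k : ℤ)) = -(k : ℤ) := by unfold skipVal; split_ifs <;> omega
  rw [hskip] at h2
  unfold arnold
  push_cast at h
  rw [h, h2]

/-- ★★★ **(4), third line**: `S_{n,−k} = S_{n,−(k+1)} + S_{n−1,k}` for `1 ≤ k < n`
(printed as `S_{n,k} = S_{n,k−1} + S_{n−1,−k}` for `−1 ≥ k > −n`).
[cite: ShinZeng2021ArnoldFamilies, Theorem 2 (Arnold) and (4) («S_{n,k} = S_{n,k−1} + S_{n−1,−k} if −1 ≥ k > −n»); Arnold1992Snakes] -/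
theorem arnold_neg_step {n k : ℕ} (hk : 1 ≤ k) (hkn : k + 1 ≤ n) :
    arnold n (-(k : ℤ)) = arnold n (-((k : ℤ) + 1)) + arnold (n - 1) k := by
  have h := arnoldCount_neg_step (S := Finset.Icc 1 n) (k := k) (k' := k + 1) (by simp) (by simp; omega)
    (by simp; omega) (by omega) (fun c _ => by omega)
  have h2 := arnoldCount_erase (n := n) (j := k) hk (by omega) (k : ℤ)
  have hskip : skipVal k (k : ℤ) = (k : ℤ) + 1 := by unfold skipVal; split_ifs <;> omega
  rw [hskip] at h2
  unfold arnold
  push_cast at h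
  rw [h, h2]

/-- ★★★ **(4), second line**: `S_{n,1} = S_{n,−1}` (`n ≥ 1`; printed for `n > 1`, at `n = 1` both are `1`).
[cite: ShinZeng2021ArnoldFamilies, Theorem 2 (Arnold) and (4) («S_{n,k} = S_{n,−1} if n > k = 1»); Arnold1992Snakes] -/
theorem arnold_one (n : ℕ) : arnold n 1 = arnold n (-1) := by
  have h := arnoldCount_min (S := Finset.Icc 1 n) (m := 1) (fun c hc => (Finset.mem_Icc.1 hc).1)
  exact_mod_cast h

/-- ★ **Boundary values**: `S_{1,1} = S_{1,−1} = 1` and `S_{n,−n} = 0` for `n ≥ 2`.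
[cite: ShinZeng2021ArnoldFamilies, (4) («S_{1,1} = S_{1,−1} = 1, S_{n,−n} = 0 (n ≥ 2)»)] -/
theorem arnold_neg_self {n : ℕ} (hn : 2 ≤ n) : arnold n (-(n : ℤ)) = 0 :=
  arnoldCount_neg_max (fun c hc => (Finset.mem_Icc.1 hc).2) (by rw [Nat.card_Icc]; omega)

/-! ### §7 The row sums: Springer numbers of types `B` and `D` -/

/-- For a nonempty alphabet the snakes of type `B` are the down-up arrangements with positive first letter.
[cite: ShinZeng2021ArnoldFamilies, §1 («a snake of type Bₙ is an alternating permutation of type Bₙ starting with a positive entry»)] -/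
theorem bSnakes_eq_filter {S : Finset ℕ} (hS : S.Nonempty) :
    bSnakes S = (duSigned S).filter fun x => 0 < x.headI := by
  ext x
  rw [bSnakes, Finset.mem_filter, mem_filter_duSigned]
  cases x with
  | nil =>
      have hnot : ([] : List ℤ) ∉ signedArrangements S := fun hx => by
        rw [mem_signedArrangements] at hx
        obtain ⟨a, ha⟩ := hS
        have : a ∈ (([] : List ℤ).map Int.natAbs).toFinset := by rw [hx.2]; exact ha
        simp at this
      simp [hnot]
  | cons a t => rw [zigzagWord_true_cons_cons]; simp only [List.headI_cons]; tauto

/-- ★★ **`S_n = K(Bₙ) = Σ_{k>0} S_{n,k}`**: the snakes of type `Bₙ` sorted by first letter.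
[cite: ShinZeng2021ArnoldFamilies, Theorem 2 (Arnold) («S_n = Σ_{k>0} #DU_{n,k}^{(B)}»)] -/
theorem card_bSnakes_eq_sum_arnold {n : ℕ} (hn : 1 ≤ n) :
    (bSnakes (Finset.Icc 1 n)).card = ∑ k ∈ Finset.Icc (1 : ℤ) n, arnold n k := by
  rw [bSnakes_eq_filter ⟨1, by simp; omega⟩]
  rw [Finset.card_eq_sum_card_fiberwise (f := List.headI) (t := Finset.Icc (1 : ℤ) n) fun x hx => ?_]
  · refine Finset.sum_congr rfl fun k hk => ?_
    rw [arnold, arnoldCount, Finset.filter_filter]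
    congr 1
    refine Finset.filter_congr fun x _ => ⟨fun h => h.2, fun h => ⟨?_, h⟩⟩
    rw [h]; exact lt_of_lt_of_le zero_lt_one (Finset.mem_Icc.1 hk).1
  · rw [Finset.mem_coe, mem_filter_duSigned] at hx
    rw [Finset.mem_coe]
    cases x with
    | nil => simp at hx
    | cons a t =>
        have ha := natAbs_mem_of_mem hx.1 (mem_cons_self)
        rw [Finset.mem_Icc] at ha ⊢
        simp only [List.headI_cons] at hx ⊢
        omega

/-- ★★ **`K(Dₙ) = Σ_{k<0} S_{n,k}`**: the down-up arrangements of `[n]` with negative first letter are equinumerous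
(negate; Hoffman's `g`) with the snakes of type `Dₙ`. [cite: ShinZeng2021ArnoldFamilies, Theorem 2 (Arnold) («for all integers −n ≤ k ≤ −1, S_{n,k} = #{σ ∈ DU_n^{(B)} : σ₁ = k}»); Hoffman1999DerivativePolynomials, §4 Theorem 4.3] -/
theorem card_dSnakes_eq_sum_arnold {n : ℕ} (hn : 1 ≤ n) :
    (dSnakes (Finset.range n)).card = ∑ k ∈ Finset.Icc (1 : ℤ) n, arnold n (-k) := by
  rw [← card_betaSnakesPos_eq_card_dSnakes hn]
  -- negation: `βₙ⁺` (up-down, positive start) ≅ down-up with negative start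
  have hinv : ∀ x : List ℤ, (x.map Neg.neg).map Neg.neg = x := fun x => by rw [map_map]; simp
  have hneg : (betaSnakesPos (Finset.Icc 1 n)).card = ((duSigned (Finset.Icc 1 n)).filter fun x => x.headI < 0).card := by
    refine Finset.card_nbij' (fun x => x.map Neg.neg) (fun x => x.map Neg.neg) ?_ ?_ (fun x _ => hinv x)
      (fun x _ => hinv x)
    · intro x hx
      rw [Finset.mem_coe, mem_betaSnakesPos] at hx
      rw [Finset.mem_coe, mem_filter_duSigned]
      refine ⟨map_neg_mem_signedArrangements hx.1, by rw [zigzagWord_map_neg]; exact hx.2.1, ?_⟩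
      cases x with
      | nil => simp at hx
      | cons a t => simp only [map_cons, List.headI_cons, Left.neg_neg_iff]; simpa using hx.2.2
    · intro x hx
      rw [Finset.mem_coe, mem_filter_duSigned] at hx
      rw [Finset.mem_coe, mem_betaSnakesPos]
      refine ⟨map_neg_mem_signedArrangements hx.1, by rw [zigzagWord_map_neg]; exact hx.2.1, ?_⟩
      cases x with
      | nil => simp at hx
      | cons a t => simp only [map_cons, List.headI_cons, Left.neg_pos_iff]; simpa using hx.2.2
  rw [hneg, Finset.card_eq_sum_card_fiberwise (f := fun x => -x.headI) (t := Finset.Icc (1 : ℤ) n) fun x hx => ?_]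
  · refine Finset.sum_congr rfl fun k hk => ?_
    rw [arnold, arnoldCount, Finset.filter_filter]
    congr 1
    refine Finset.filter_congr fun x _ => ⟨fun h => by rw [← h.2, neg_neg], fun h => ⟨?_, by rw [h, neg_neg]⟩⟩
    rw [h]; have := (Finset.mem_Icc.1 hk).1; omega
  · rw [Finset.mem_coe, mem_filter_duSigned] at hx
    rw [Finset.mem_coe]
    cases x with
    | nil => simp at hx
    | cons a t =>
        have ha := natAbs_mem_of_mem hx.1 (mem_cons_self)
        rw [Finset.mem_Icc] at ha ⊢
        simp only [List.headI_cons] at hx ⊢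
        omega

/-- ★★★ **The Springer numbers as row sums of Arnold's triangle**: `Σ_{k=1}^{n} S_{n,k} = Qₙ(1) = Sₙ` and
`Σ_{k=1}^{n} S_{n,−k} = Pₙ(1) − Qₙ(1) = card Dₙ` (`n ≥ 1`).
[cite: ShinZeng2021ArnoldFamilies, Theorem 2 (Arnold) («S_n = Σ_{k>0} #DU^{(B)}_{n,k}»); Hoffman1999DerivativePolynomials, §4 Proposition 4.1, Theorem 4.3] -/
theorem sum_arnold {n : ℕ} (hn : 1 ≤ n) :
    ∑ k ∈ Finset.Icc (1 : ℤ) n, arnold n k = (TangentNumbers.Q n).eval 1 ∧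
      ∑ k ∈ Finset.Icc (1 : ℤ) n, arnold n (-k) = (TangentNumbers.P n).eval 1 - (TangentNumbers.Q n).eval 1 := by
  rw [← card_bSnakes_eq_sum_arnold hn, ← card_dSnakes_eq_sum_arnold hn, card_bSnakes_Icc, card_dSnakes_range hn]
  exact ⟨rfl, rfl⟩

/-- ★ **Boundary values** `S_{1,1} = S_{1,−1} = 1`. [cite: ShinZeng2021ArnoldFamilies, (4) («S_{1,1} = S_{1,−1} = 1»)] -/
theorem arnold_one_one : arnold 1 1 = 1 ∧ arnold 1 (-1) = 1 := by
  have h := (sum_arnold (n := 1) le_rfl).1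
  rw [show (((1 : ℕ) : ℤ)) = 1 from rfl, Finset.Icc_self, Finset.sum_singleton] at h
  have hq := DerivativePolynomials.eval_one_Q_values
  simp only [List.cons.injEq] at hq
  have h1 : arnold 1 1 = 1 := by rw [h]; exact hq.2.1
  exact ⟨h1, by rw [← arnold_one]; exact h1⟩

/-- ★ **Arnold's pair of triangles, rows 1–4** (by enumeration of the signed down-up arrangements):
`S_{n,k}` for `k = 1..n`: `1 / 1 2 / 3 4 4 / 11 14 16 16`, and for `k = −1..−n`: `1 / 1 0 / 3 2 0 / 11 8 4 0`
(row sums `1, 3, 11, 57` and `1, 1, 5, 23`).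
[cite: ShinZeng2021ArnoldFamilies, §1 (the two printed triangles «1 / 2 1 / 0 2 3 / 16 16 14 11» and «1 / 1 0 / 3 4 4 / 11 8 4 0»)] -/
theorem arnold_rows :
    ((List.range' 1 3).permutations'.flatMap signings).countP (fun x => zigzagWord false x && (x.headI == 1)) = 3 ∧
    ((List.range' 1 3).permutations'.flatMap signings).countP (fun x => zigzagWord false x && (x.headI == 2)) = 4 ∧
    ((List.range' 1 3).permutations'.flatMap signings).countP (fun x => zigzagWord false x && (x.headI == 3)) = 4 ∧
    ((List.range' 1 3).permutations'.flatMap signings).countP (fun x => zigzagWord false x && (x.headI == -1)) = 3 ∧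
    ((List.range' 1 3).permutations'.flatMap signings).countP (fun x => zigzagWord false x && (x.headI == -2)) = 2 ∧
    ((List.range' 1 3).permutations'.flatMap signings).countP (fun x => zigzagWord false x && (x.headI == -3)) = 0 ∧
    ((List.range' 1 4).permutations'.flatMap signings).countP (fun x => zigzagWord false x && (x.headI == 1)) = 11 ∧
    ((List.range' 1 4).permutations'.flatMap signings).countP (fun x => zigzagWord false x && (x.headI == 2)) = 14 ∧
    ((List.range' 1 4).permutations'.flatMap signings).countP (fun x => zigzagWord false x && (x.headI == 3)) = 16 ∧
    ((List.range' 1 4).permutations'.flatMap signings).countP (fun x => zigzagWord false x && (x.headI == 4)) = 16 ∧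
    ((List.range' 1 4).permutations'.flatMap signings).countP (fun x => zigzagWord false x && (x.headI == -1)) = 11 ∧
    ((List.range' 1 4).permutations'.flatMap signings).countP (fun x => zigzagWord false x && (x.headI == -2)) = 8 ∧
    ((List.range' 1 4).permutations'.flatMap signings).countP (fun x => zigzagWord false x && (x.headI == -3)) = 4 ∧
    ((List.range' 1 4).permutations'.flatMap signings).countP (fun x => zigzagWord false x && (x.headI == -4)) = 0 := by
  refine ⟨by decide, by decide, by decide, by decide, by decide, by decide, by decide +kernel, by decide +kernel,
    by decide +kernel, by decide +kernel, by decide +kernel, by decide +kernel, by decide +kernel, by decide +kernel⟩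

/-! ### §8 Uniqueness: the printed definition of `S_{n,k}` by (4) -/

/-- ★★★ **Arnold's theorem, verbatim form.**  [ShinZeng2021ArnoldFamilies] *define* `S_{n,k}` by the boundary values
`S_{1,1} = S_{1,−1} = 1`, `S_{n,−n} = 0 (n ≥ 2)` and the recurrence (4); Theorem 2 (Arnold) then says that these
numbers count the down-up signed permutations by first letter.  Having proved that the counts `arnold n k` satisfy
the system (§6), it remains to note that the system has at most one solution on `1 ≤ |k| ≤ n`: any array `f`
satisfying it agrees with `arnold` (induction on `n`; inside a row first `k = −n, …, −1` by the third line, then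
`k = 1` by the second, then `k = 2, …, n` by the first).
[cite: ShinZeng2021ArnoldFamilies, §1 eq. (4) with its boundary values («where S_{n,k} is defined by S_{1,1} = S_{1,−1} = 1, S_{n,−n} = 0 (n ≥ 2), and the recurrence (4)») and Theorem 2 (Arnold)] -/
theorem arnold_unique (f : ℕ → ℤ → ℕ) (h11 : f 1 1 = 1) (h1m : f 1 (-1) = 1)
    (hnn : ∀ n : ℕ, 2 ≤ n → f n (-(n : ℤ)) = 0)
    (hpos : ∀ n k : ℕ, 1 ≤ k → k + 1 ≤ n → f n ((k : ℤ) + 1) = f n k + f (n - 1) (-(k : ℤ)))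
    (hone : ∀ n : ℕ, 2 ≤ n → f n 1 = f n (-1))
    (hneg : ∀ n k : ℕ, 1 ≤ k → k + 1 ≤ n → f n (-(k : ℤ)) = f n (-((k : ℤ) + 1)) + f (n - 1) k) :
    ∀ (n : ℕ) (k : ℤ), 1 ≤ k.natAbs → k.natAbs ≤ n → f n k = arnold n k := by
  intro n
  induction n using Nat.strong_induction_on with
  | _ n ih =>
    intro k hk1 hkn
    -- the negative half of row `n`, from `−n` upwards
    have hnegrow : ∀ d j : ℕ, j + d = n → 1 ≤ j → f n (-(j : ℤ)) = arnold n (-(j : ℤ)) := by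
      intro d
      induction d with
      | zero =>
          intro j hj hj1
          rw [add_zero] at hj; subst hj
          rcases Nat.lt_or_ge j 2 with h | h
          · obtain rfl : j = 1 := by omega
            rw [Nat.cast_one, h1m, arnold_one_one.2]
          · rw [hnn j h, arnold_neg_self h]
      | succ d ihd =>
          intro j hj hj1
          have h1 := ihd (j + 1) (by omega) (by omega)
          push_cast at h1
          rw [hneg n j hj1 (by omega), arnold_neg_step hj1 (by omega), h1,
            ih (n - 1) (by omega) (j : ℤ) (by simp; omega) (by simp; omega)]
    -- the positive half, from `1` upwards
    have hposrow : ∀ j : ℕ, 1 ≤ j → j ≤ n → f n (j : ℤ) = arnold n (j : ℤ) := by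
      intro j
      induction j with
      | zero => intro h; omega
      | succ j ihj =>
          intro _ hjn
          rcases Nat.eq_zero_or_pos j with rfl | hj
          · rcases Nat.lt_or_ge n 2 with h | h
            · obtain rfl : n = 1 := by omega
              rw [zero_add, Nat.cast_one, h11, arnold_one_one.1]
            · have h1 := hnegrow (n - 1) 1 (by omega) le_rfl
              rw [Nat.cast_one] at h1
              rw [zero_add, Nat.cast_one, hone n h, arnold_one, h1]
          · rw [Nat.cast_succ, hpos n j hj hjn, arnold_pos_step hj hjn, ihj hj (by omega),
              ih (n - 1) (by omega) (-(j : ℤ)) (by simp; omega) (by simp; omega)]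
    rcases Int.natAbs_eq k with h | h
    · rw [h]; exact hposrow k.natAbs hk1 hkn
    · rw [h]; exact hnegrow (n - k.natAbs) k.natAbs (by omega) hk1

end Snakes
end Literature.Combinatorics.Enumerative
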